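import Literature.AlgebraicTopology.SingularHomology.FiniteCoverNorm
import HarnessLib

/-!
# The projection formula for the normalised transfer of a finite covering (no deck group)

For a finite covering map `p : E → B` of topological spaces (the tree's `IsFiniteCover p`: a covering map,
surjective, with finite fibres) the NORMALISED transfer `τ' : Hⁿ(E; R) → Hⁿ(B; R)` of
`FiniteCoverTransfer` (`IsFiniteCover.transferMap`; on cochains `(τ'ψ)(σ) = (#lifts σ)⁻¹ ∑_{σ̃ ↦ σ} ψ(σ̃)`,
so that `τ' ∘ p^* = id`, `IsFiniteCover.transferMap_map`) satisfies the **projection formula**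

* `IsFiniteCover.transferMap_cupProduct_map_left`:  `τ'(p^* a ⌣ b) = a ⌣ τ' b`,
* `IsFiniteCover.transferMap_cupProduct_map_right`: `τ'(b ⌣ p^* a) = τ' b ⌣ a`,
* `IsFiniteCover.transferMap_cupProduct_map_cupProduct_map` (twisted form):
  `τ'((p^* ℓ ⌣ x) ⌣ p^* y) = (ℓ ⌣ τ' x) ⌣ y`,

for ANY finite covering — no deck group and no regularity are assumed (the tree's
`FiniteDeckTransferProjectionFormula` is the version for the un-normalised transfer of a finite GALOIS
covering `FiniteDeckCover`).  The proof is Hatcher's: on cochains, a lift `σ̃` of an `n`-simplex `σ` has front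
face a lift of the front face of `σ` and back face a lift of the back face, and summing over the lifts of a
face is summing over the lifts of `σ` (`sum_liftsFinset_frontFace/backFace`, by induction from the tree's
codimension-one `IsFiniteCover.sum_liftsFinset_face`); the number of lifts — hence the normalising weight —
is the same for `σ` and its faces (`weight_frontFace/backFace`).  Passing to cohomology uses
`IsFiniteCover.transferMap_π` (tree, `FiniteCoverNorm`) and `iCocycles_cyclesMap_transfer`.

Written for the Hecke correspondences `X_{Γ'} ⇉ X_Γ` of compact ball quotients, whose second leg (the Hecke
translate) is a finite covering that is not Galois in general (cell pub-hodgecm2, lane «L-BYPASS»; kernel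
text by the seat pub-hodgecm2-s2crux-idea-2 (probe `RA-v22`, gen 7), filed by b10).  Theorems only; no
named fact.

References: A. Hatcher, *Algebraic Topology* (2002), §3.G (transfer homomorphisms, p. 321) and §3.2
Prop. 3.10 (naturality of cup product) [HatcherAT2002].
-/

noncomputable section

open CategoryTheory


namespace Literature.AlgebraicTopology.SingularHomology.IsFiniteCover

universe u v

variable {E B : Type u} [TopologicalSpace E] [TopologicalSpace B] {proj : C(E, B)}
  (c : IsFiniteCover proj) {p q n : ℕ}

/-! ### Lifts of front and back faces -/

/-- The front `p`-face induces a bijection `lifts σ ≃ lifts σ|[v₀,…,vₚ]` (counted). [cite: HatcherAT2002, §3.G p. 321] -/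
lemma card_liftsFinset_frontFace {m : ℕ} (h : p ≤ m) (σ : SingularSimplex B m) :
    (c.liftsFinset (σ.frontFace h)).card = (c.liftsFinset σ).card := by
  induction m, h using Nat.le_induction with
  | base => rw [SingularSimplex.frontFace_self]
  | succ m h ih =>
    rw [← SingularSimplex.frontFace_face_of_lt (Fin.last (m + 1)) h (Nat.lt_succ_of_le h) σ, ih,
      c.card_liftsFinset_face]

/-- The back `q`-face induces a bijection `lifts σ ≃ lifts σ|[vₘ₋q,…,vₘ]` (counted). [cite: HatcherAT2002, §3.G p. 321] -/
lemma card_liftsFinset_backFace {m : ℕ} (h : q ≤ m) (σ : SingularSimplex B m) :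
    (c.liftsFinset (σ.backFace h)).card = (c.liftsFinset σ).card := by
  induction m, h using Nat.le_induction with
  | base => rw [SingularSimplex.backFace_self]
  | succ m h ih =>
    have h0 : ((⟨0, by omega⟩ : Fin (m + 2)) : ℕ) + q ≤ m := by
      change 0 + q ≤ m
      omega
    rw [← SingularSimplex.backFace_face_of_le ⟨0, by omega⟩ h h0 σ, ih, c.card_liftsFinset_face]

/-- Summing over the lifts of `σ|[v₀,…,vₚ]` is summing `a ↦ a|[v₀,…,vₚ]` over the lifts of `σ`.
[cite: HatcherAT2002, §3.G p. 321] -/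
lemma sum_liftsFinset_frontFace {M : Type*} [AddCommMonoid M] (g : SingularSimplex E p → M) {m : ℕ}
    (h : p ≤ m) (σ : SingularSimplex B m) :
    ∑ b ∈ c.liftsFinset (σ.frontFace h), g b = ∑ a ∈ c.liftsFinset σ, g (a.frontFace h) := by
  induction m, h using Nat.le_induction with
  | base => simp only [SingularSimplex.frontFace_self]
  | succ m h ih =>
    rw [← SingularSimplex.frontFace_face_of_lt (Fin.last (m + 1)) h (Nat.lt_succ_of_le h) σ, ih,
      c.sum_liftsFinset_face σ (Fin.last (m + 1))]
    exact Finset.sum_congr rfl fun a _ => by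
      rw [SingularSimplex.frontFace_face_of_lt (Fin.last (m + 1)) h (Nat.lt_succ_of_le h) a]

/-- Summing over the lifts of `σ|[vₘ₋q,…,vₘ]` is summing `a ↦ a|[vₘ₋q,…,vₘ]` over the lifts of `σ`.
[cite: HatcherAT2002, §3.G p. 321] -/
lemma sum_liftsFinset_backFace {M : Type*} [AddCommMonoid M] (g : SingularSimplex E q → M) {m : ℕ}
    (h : q ≤ m) (σ : SingularSimplex B m) :
    ∑ b ∈ c.liftsFinset (σ.backFace h), g b = ∑ a ∈ c.liftsFinset σ, g (a.backFace h) := by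
  induction m, h using Nat.le_induction with
  | base => simp only [SingularSimplex.backFace_self]
  | succ m h ih =>
    have h0 : ((⟨0, by omega⟩ : Fin (m + 2)) : ℕ) + q ≤ m := by
      change 0 + q ≤ m
      omega
    rw [← SingularSimplex.backFace_face_of_le ⟨0, by omega⟩ h h0 σ, ih, c.sum_liftsFinset_face σ ⟨0, by omega⟩]
    exact Finset.sum_congr rfl fun a _ => by
      rw [SingularSimplex.backFace_face_of_le ⟨0, by omega⟩ h h0 a]

variable {R : Type v} [CommRing R] [Algebra ℚ R]

/-- The normalising weight `(#lifts)⁻¹` of the front face equals the weight of the simplex. [cite: HatcherAT2002, §3.G p. 321] -/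
lemma weight_frontFace {m : ℕ} (h : p ≤ m) (σ : SingularSimplex B m) :
    c.weight (R := R) (σ.frontFace h) = c.weight σ := by
  rw [weight, weight, c.card_liftsFinset_frontFace h σ]

/-- The normalising weight `(#lifts)⁻¹` of the back face equals the weight of the simplex. [cite: HatcherAT2002, §3.G p. 321] -/
lemma weight_backFace {m : ℕ} (h : q ≤ m) (σ : SingularSimplex B m) :
    c.weight (R := R) (σ.backFace h) = c.weight σ := by
  rw [weight, weight, c.card_liftsFinset_backFace h σ]

/-! ### The projection formula on cochains -/

/-- **Projection formula on cochains, pull-back on the left: `τ'(p^♯φ ⌣ ψ) = φ ⌣ τ'ψ`** for the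
normalised transfer of a finite covering (no deck group). [cite: HatcherAT2002, §3.G p. 321 and §3.2 p. 206] -/
theorem transferCochain_cochainCup_map_left (h : p + q = n) (φ : SingularSimplex B p → R)
    (ψ : SingularSimplex E q → R) :
    c.transferCochain n (cochainCup h ((singularCochainComplex.map R R proj).f p φ) ψ) =
      cochainCup h φ (c.transferCochain q ψ) := by
  funext σ
  simp only [transferCochain_apply, cochainCup_apply, singularCochainComplex.map_apply]
  rw [c.weight_backFace (by omega) σ, c.sum_liftsFinset_backFace ψ (by omega) σ]
  simp only [Finset.mul_sum]
  refine Finset.sum_congr rfl fun a ha => ?_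
  rw [← SingularSimplex.frontFace_map, c.mem_liftsFinset.1 ha]
  ring

/-- **Projection formula on cochains, pull-back on the right: `τ'(ψ ⌣ p^♯φ) = τ'ψ ⌣ φ`.**
[cite: HatcherAT2002, §3.G p. 321 and §3.2 p. 206] -/
theorem transferCochain_cochainCup_map_right (h : p + q = n) (ψ : SingularSimplex E p → R)
    (φ : SingularSimplex B q → R) :
    c.transferCochain n (cochainCup h ψ ((singularCochainComplex.map R R proj).f q φ)) =
      cochainCup h (c.transferCochain p ψ) φ := by
  funext σ
  simp only [transferCochain_apply, cochainCup_apply, singularCochainComplex.map_apply]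
  rw [c.weight_frontFace (by omega) σ, c.sum_liftsFinset_frontFace ψ (by omega) σ]
  simp only [Finset.mul_sum, Finset.sum_mul]
  refine Finset.sum_congr rfl fun a ha => ?_
  rw [← SingularSimplex.backFace_map, c.mem_liftsFinset.1 ha]
  ring

/-! ### The projection formula in cohomology -/

/-- The cochain underlying `cyclesMap τ' z` is `τ' z` (companion of the tree's `IsFiniteCover.transferMap_π`:
`τ'^*[z] = [τ' z]`). [cite: HatcherAT2002, §3.G p. 321] -/
lemma iCocycles_cyclesMap_transfer {k : ℕ} (z : singularCochainComplex.cocycles R R E k) :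
    singularCochainComplex.iCocycles R R B k (HomologicalComplex.cyclesMap (c.transfer (R := R)) k z) =
      (c.transfer (R := R)).f k (singularCochainComplex.iCocycles R R E k z) := by
  change (HomologicalComplex.cyclesMap c.transfer _ ≫ singularCochainComplex.iCocycles R R B _) z =
    (singularCochainComplex.iCocycles R R E _ ≫ (c.transfer (R := R)).f _) z
  rw [HomologicalComplex.cyclesMap_i]

/-- **Projection formula: `τ'^*(p^* a ⌣ b) = a ⌣ τ'^* b`** in `Hⁿ(B; R)`, `a ∈ Hᵖ(B; R)`, `b ∈ Hᵠ(E; R)`,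
for the normalised transfer of ANY finite covering (no deck group; compare the tree's
`FiniteDeckCover.transferMap_cupProduct_map_left` for finite Galois coverings).
[cite: HatcherAT2002, §3.G p. 321 and Prop. 3.10] -/
theorem transferMap_cupProduct_map_left (h : p + q = n) (a : singularCohomology R R B p)
    (b : singularCohomology R R E q) :
    c.transferMap n (cupProduct h (singularCohomology.map R R proj p a) b) =
      cupProduct h a (c.transferMap q b) := by
  induction a using singularCohomology_induction_on with
  | h a =>
  induction b using singularCohomology_induction_on with
  | h b =>
    rw [singularCohomology.map_π, cupProduct_π_π, c.transferMap_π _, c.transferMap_π _, cupProduct_π_π]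
    congr 1
    refine singularCochainComplex.cocycles_ext ?_
    rw [c.iCocycles_cyclesMap_transfer, singularCochainComplex.iCocycles_cocyclesCup,
      singularCochainComplex.iCocycles_cocyclesCup, singularCochainComplex.iCocycles_cocyclesMap,
      c.iCocycles_cyclesMap_transfer]
    exact c.transferCochain_cochainCup_map_left h _ _

/-- **Projection formula: `τ'^*(b ⌣ p^* a) = τ'^* b ⌣ a`** in `Hⁿ(B; R)`, `b ∈ Hᵖ(E; R)`, `a ∈ Hᵠ(B; R)`.
[cite: HatcherAT2002, §3.G p. 321 and Prop. 3.10] -/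
theorem transferMap_cupProduct_map_right (h : p + q = n) (b : singularCohomology R R E p)
    (a : singularCohomology R R B q) :
    c.transferMap n (cupProduct h b (singularCohomology.map R R proj q a)) =
      cupProduct h (c.transferMap p b) a := by
  induction a using singularCohomology_induction_on with
  | h a =>
  induction b using singularCohomology_induction_on with
  | h b =>
    rw [singularCohomology.map_π, cupProduct_π_π, c.transferMap_π _, c.transferMap_π _, cupProduct_π_π]
    congr 1
    refine singularCochainComplex.cocycles_ext ?_
    rw [c.iCocycles_cyclesMap_transfer, singularCochainComplex.iCocycles_cocyclesCup,
      singularCochainComplex.iCocycles_cocyclesCup, singularCochainComplex.iCocycles_cocyclesMap,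
      c.iCocycles_cyclesMap_transfer]
    exact c.transferCochain_cochainCup_map_right h _ _

/-- **Twisted form: `τ'^*((p^* ℓ ⌣ x) ⌣ p^* y) = (ℓ ⌣ τ'^* x) ⌣ y`** — the shape in which a
`κ`-twisted cup pairing `Q(x, y) = t((κ ⌣ x) ⌣ y)` (e.g. the polarisation form on `H¹` of a surface) meets
the transfer.
[cite: HatcherAT2002, §3.G p. 321 and Prop. 3.10] -/
theorem transferMap_cupProduct_map_cupProduct_map {k m s t : ℕ} (h1 : s + k = m) (h2 : m + k = t)
    (ℓ : singularCohomology R R B s) (x : singularCohomology R R E k) (y : singularCohomology R R B k) :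
    c.transferMap t (cupProduct h2 (cupProduct h1 (singularCohomology.map R R proj s ℓ) x)
      (singularCohomology.map R R proj k y)) =
      cupProduct h2 (cupProduct h1 ℓ (c.transferMap k x)) y := by
  rw [c.transferMap_cupProduct_map_right h2, c.transferMap_cupProduct_map_left h1]

end Literature.AlgebraicTopology.SingularHomology.IsFiniteCover

end
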